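import Literature.AlgebraicGeometry.HodgeTheory.RealCharactersSp4SlotsHodgeClasses
import Literature.AlgebraicGeometry.HodgeTheory.RealSl2BlocksProducts
import HarnessLib

/-!
# Real `𝔰𝔭₄`-block data on `H¹` of an abelian variety with commutative `End⁰` (Moonen–Zarhin 1995 Type I(2) / Murty 1984 §3 in the form stable under orthogonal products): `B = D` for everything with slots over a carrier, condition (D), the Hodge conjecture for all powers; the real-multiplication instance of relative dimension two; orthogonal products (Hazama 1989 / Moonen–Zarhin 1999 Thm. (3.2)(1) for this class, unconditionally)

Family `hodge`, layer `Literature/AlgebraicGeometry/HodgeTheory`. Research context: cell `pub-hodge-ring2`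
(HONEST FRAMING: research route conditional on HC_CM; not a corollary; Q11.4-sentence-2 already refuted in
dim ≥ 3), Literature lane gen 70, programme R47 (heir H1b′). UNCONDITIONAL; ONE definition (`HasRealSp4Blocks`, a
`Prop`-valued predicate WITH BODY — not a named fact); no named fact; no `sorry`; no step towards a summit statement
beyond the published theorems it assembles. The rank-four twin of the tree's `RealSl2Blocks` / `RealSl2BlocksProducts`
(Hazama–Ribet in relative dimension one).

THE NOTION. `HasRealSp4Blocks A`: `End⁰(A)` is commutative and there are finitely many REAL characters
`τ_i : End⁰(A) → ℂ` whose joint eigenspaces `V_i = ⋂_e ker(e^* ⊗ ℂ − τ_i(e))` on `H¹(A) ⊗ ℂ` form an internal direct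
sum with `dim V_i = 4`. (Nothing else: for ANY polarization `ψ` the blocks are `ψ_ℂ`-orthogonal — self-adjointness
of `End⁰` is automatic for real characters, `isAdjointPair_self_of_real_characters` —, Hodge–Darboux bases exist
(`exists_hodgeDarboux_blockBasis_four`) and their symplectic classes `ρ(b₀) ⌣ ρ(b₂) + ρ(b₁) ⌣ ρ(b₃)` are
`ℂ`-combinations of rational `(1,1)`-classes by §1.)

RESULTS.
* §1 (`End⁰(A)` not assumed a field) the `ψ`-Casimir class in a family of characters and the THEOREM
  `thetaFour_mem_span_rational_oneOne_of_characters`: `θ_τ ∈ B¹(A) ⊗ ℂ` for Hodge–Darboux block bases (Murty 1984 §3 /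
  Milne 1999 Prop. 3.6 (a): the symplectic form of each block is a divisor class) — verbatim the field case
  `thetaFour_mem_span_rational_oneOne` of `RealMultiplicationRelDimTwoDivisorClasses`, with `hodgeCharacter` replaced by an
  injective family of characters and self-adjointness assumed.
* §2 `HasRealSp4Blocks` and its consequences: **`HasRealSp4Blocks.isDivisorGenerated_of_avSlots`** (`B• = D• ⊗ ℂ` for
  every `B` with slots over `A`; Riemann `End⁰(A) ≃ End_Hdg(H¹ A)` for commutative `End⁰`, `endAlgebraAlgEquivEndAlgOfComm`;
  then `AVSlots.isDivisorGenerated_of_sp4BlockBasis` of `RealCharactersSp4SlotsHodgeClasses`), `…isDivisorGenerated_powSucc`,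
  **`…isStablyNondegenerate`** (condition (D)), **`…hodgeConjectureFor_powSucc`**, `…hodgeConjectureFor_of_isIsogenous_powSucc`,
  `…hasNoTypeIVFactor`.
* §3 **`hasRealSp4Blocks_of_isTotallyReal_of_two_mul_finrank_eq`** — `End⁰(A) = F` a totally real field with
  `2[F:ℚ] = dim A` is a carrier (the tree's `embCharacter` indexing; blocks of dimension four by
  `finrank_eigenBlock_hodgeCharacter_eq_four`); isogeny closure.
* §4 **`HasRealSp4Blocks.prod`** — carriers are stable under orthogonal products (`Hom(A, B) = 0 = Hom(B, A)`; the
  characters of `End⁰(A × B)` are the `τ ∘ corner_i`, their blocks the `pr_i^* V_τ`, `HOneOfProductEndomorphismBlocks`),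
  hence **`B•((A × B)ⁿ) = D•((A × B)ⁿ) ⊗ ℂ`, condition (D) for `A × B`, the Hodge conjecture for every `(A × B)^{N+1}`,
  every `A^{M+1} × B^{N+1}` and everything isogenous to one — UNCONDITIONALLY** for two orthogonal
  relative-dimension-two real-multiplication varieties (Moonen–Zarhin Thm. (3.2)(1) = Hazama 1989 ON THIS CLASS, now
  a theorem: the conclusion of the tree's named fact `Hazama1989_stablyNondegenerate_prod` for such `A`, `B` without
  the fact; `isStablyNondegenerate_powSucc_prod_powSucc_of_relDimTwo` supersedes the `_of_hazama` form of
  `StablyNondegenerateRelDimTwo` for orthogonal factors).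

## References

* [MoonenZarhin1995Duke] B. Moonen, Yu. Zarhin, Duke Math. J. 77 (1995), Type I(2). [cite: MoonenZarhin1995Duke, Type I(2)]
* [Murty1984] V. K. Murty, Math. Ann. 268 (1984), §3. [cite: Murty1984, §3]
* [Milne1999LefschetzClasses] J. S. Milne, Duke Math. J. 96 (1999), Prop. 3.6 (a), p. 654. [cite: Milne1999LefschetzClasses, §3 Prop. 3.6 (a) and p. 654]
* [Hazama1983] F. Hazama, *Algebraic cycles on abelian varieties with many real endomorphisms*, Tôhoku Math. J. 35
  (1983) 303–308, Thm. (1.1), §3. [cite: Hazama1983, §3 (pp. 305–306)]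
* [Hazama1989] F. Hazama, Duke Math. J. 58 (1989) 31–37. [cite: Hazama1989, Thm. (= Gordon 7.6.2)]
* [MoonenZarhin1999LowDim] B. Moonen, Yu. Zarhin, Math. Ann. 315 (1999), §1, §3 Thm. (3.2)(1). [cite: MoonenZarhin1999LowDim, §3 Thm. (3.2)(1)]
* [Ribet1983] K. A. Ribet, Amer. J. Math. 105 (1983), Thm. 0. [cite: Ribet1983, Thm. 0]
* [Gordon1999HodgeAVSurvey] B. B. Gordon, survey, Thm. 7.5, Def. 7.6, Thm. 7.6.2. [cite: Gordon1999HodgeAVSurvey, Thm. 7.5 (1) and Def. 7.6]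
* [Deligne1982HodgeCycles] P. Deligne, LNM 900, §4 p. 30. [cite: Deligne1982HodgeCycles, §4 p. 30]
* [vanGeemen1994HodgeAV] B. van Geemen, Lemma 3.7. [cite: vanGeemen1994HodgeAV, Lemma 3.7]
-/

noncomputable section

open scoped TensorProduct
open CategoryTheory Module NumberField

namespace Literature.AlgebraicGeometry.HodgeTheory

open Literature.AlgebraicTopology.SingularHomology
open Literature.AlgebraicGeometry.Motives (IsSmoothProjective AbelianVariety bettiCohomology
  ofRatClassBaseChange ofRatClassBaseChange_tmul HodgeTensorFacts hodgeTensorFacts_holds)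
open Literature.Barriers.HodgeConjecture
open Literature.AlgebraicGeometry.Motives.HodgeStructure
open Literature.AlgebraicGeometry.ComplexMultiplication
open Literature.RepresentationTheory.GeneralLinear
open Literature.NumberTheory.DiophantineGeometry

/-! ### §1 The `ψ`-Casimir classes on four-dimensional blocks of a family of characters (`End⁰(A)` not a field) -/

section Characters

variable {A : AbelianVariety ℂ}

/-- **The Casimir class computed in a block family and its blockwise dual family** (any block size): for
block bases `b_τ` of `H ⊗ ℂ = ⊕_τ V_τ` and vectors `d(τ, a) ∈ V_τ` with `ψ_ℂ(d(τ,a), b_τ c) = δ_{ac}`,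
`Λ(Y) = ∑_τ ∑_a ρ(Y d(τ,a)) ⌣ ρ(b_τ a)` (independence of the Casimir contraction from the pair of dual bases,
`sum_dual_eq_sum_dual`; the blocks are `ψ_ℂ`-orthogonal because `End_Hdg` is `ψ`-self-adjoint and the characters are distinct).
[cite: Hazama1983, §3 (p. 305)] [cite: GoodmanWallachGTM255, §4.1.1] -/
theorem casimirClass_eq_sum_dualFamily_of_characters (hHD : exists_isReal_hodgeModel)
    (ψ : (BettiUniverse.hodge hHD (AbelianVariety.isSmoothProjective_holds (A := A)) 1).Polarization)
    (hself : ∀ a : (BettiUniverse.hodge hHD (AbelianVariety.isSmoothProjective_holds (A := A)) 1).endAlg,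
      LinearMap.IsAdjointPair ψ.form ψ.form (a : Module.End ℚ (bettiCohomology A.X 1))
        (a : Module.End ℚ (bettiCohomology A.X 1)))
    {T : Type} [Fintype T] [DecidableEq T]
    (σ : T → ((BettiUniverse.hodge hHD (AbelianVariety.isSmoothProjective_holds (A := A)) 1).endAlg →+* ℂ)) (hσ : Function.Injective σ)
    (hint : DirectSum.IsInternal fun τ => (BettiUniverse.hodge hHD (AbelianVariety.isSmoothProjective_holds (A := A)) 1).eigenBlock (σ τ))
    {m : ℕ} (b : ∀ τ : T, Module.Basis (Fin m) ℂ
      ((BettiUniverse.hodge hHD (AbelianVariety.isSmoothProjective_holds (A := A)) 1).eigenBlock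
        (σ τ)))
    (d : T × Fin m → ℂ ⊗[ℚ] bettiCohomology A.X 1)
    (hdT : ∀ τ a, d (τ, a) ∈
      (BettiUniverse.hodge hHD (AbelianVariety.isSmoothProjective_holds (A := A)) 1).eigenBlock
        (σ τ))
    (hdual : ∀ τ a c, ψ.form.baseChange ℂ (d (τ, a)) (b τ c : ℂ ⊗[ℚ] bettiCohomology A.X 1) =
      if a = c then 1 else 0)
    {ι : Type*} [Fintype ι] [DecidableEq ι] (e : Module.Basis ι ℚ (bettiCohomology A.X 1))
    (Y : Module.End ℂ (ℂ ⊗[ℚ] bettiCohomology A.X 1)) :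
    casimirClass A ψ.form ψ.nondegenerate e Y =
      ∑ τ, ∑ a, cupH1 A (Y (d (τ, a))) (b τ a : ℂ ⊗[ℚ] bettiCohomology A.X 1) := by
  classical
  haveI : Module.Finite ℚ (bettiCohomology A.X 1) := finite_bettiCohomology_one A
  have hX : IsSmoothProjective A.dim A.X := AbelianVariety.isSmoothProjective_holds
  set Ψ := ψ.form.baseChange ℂ with hΨ
  set w' : T × Fin m → ℂ ⊗[ℚ] bettiCohomology A.X 1 := fun τr => b τr.1 τr.2
    with hw'
  have hdual' : ∀ j k, Ψ (d j) (w' k) = if k = j then 1 else 0 := by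
    rintro ⟨τ, a⟩ ⟨τ', c⟩
    change Ψ (d (τ, a)) (b τ' c : ℂ ⊗[ℚ] bettiCohomology A.X 1) = _
    by_cases hττ' : τ = τ'
    · subst hττ'
      rw [hΨ, hdual]
      by_cases hac : a = c
      · subst hac; rw [if_pos rfl, if_pos rfl]
      · rw [if_neg hac, if_neg (fun h => hac (congrArg Prod.snd h).symm)]
    · rw [if_neg (fun h => hττ' (congrArg Prod.fst h).symm)]
      exact form_eq_zero_of_mem_eigenBlock_of_isAdjointPair (BettiUniverse.hodge hHD hX 1) ψ hself
        (fun h => hττ' (hσ h)) (hdT τ a) (b τ' c).2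
  -- separation: a vector orthogonal to all `d(τ, a)` has all block coordinates zero
  have hsep : ∀ y, (∀ j, Ψ (d j) y = 0) → y = 0 := by
    intro y hy
    set cb := hint.collectedBasis b with hcb
    have hcb_apply : ∀ τ c, cb ⟨τ, c⟩ = (b τ c : ℂ ⊗[ℚ] bettiCohomology A.X 1) := fun τ c => by
      rw [hcb, DirectSum.IsInternal.collectedBasis_coe]
    have hcoord : ∀ τ a, cb.repr y ⟨τ, a⟩ = 0 := by
      intro τ a
      have h := hy (τ, a)
      rw [← cb.sum_repr y, map_sum, Finset.sum_eq_single (⟨τ, a⟩ : Σ _ : T, Fin m)] at h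
      · rwa [map_smul, smul_eq_mul, hcb_apply, hdual, if_pos rfl, mul_one] at h
      · rintro ⟨τ', c⟩ _ hne
        rw [map_smul, smul_eq_mul, hcb_apply,
          show (b τ' c : ℂ ⊗[ℚ] bettiCohomology A.X 1) = w' (τ', c) from rfl, hdual',
          if_neg (fun h => hne (by cases h; rfl)), mul_zero]
      · intro h; exact absurd (Finset.mem_univ _) h
    rw [← cb.sum_repr y]
    refine Finset.sum_eq_zero fun j _ => ?_
    obtain ⟨τ, a⟩ := j
    rw [hcoord, zero_smul]
  rw [casimirClass_apply, sum_dual_eq_sum_dual Ψ (cupH1 A) _ _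
    (eq_sum_formBaseChange_smul_dualBasis ψ.form ψ.nondegenerate e) w' d hdual' hsep Y,
    Fintype.sum_prod_type]

/-- **The Casimir class in Hodge–Darboux block coordinates** (four-dimensional blocks with Gram matrix
`( 0 I ; -I 0 )`): `Λ(Y) = ∑_τ [ρ(Y b_τ0) ⌣ ρ(b_τ2) − ρ(Y b_τ2) ⌣ ρ(b_τ0) + ρ(Y b_τ1) ⌣ ρ(b_τ3) − ρ(Y b_τ3) ⌣ ρ(b_τ1)]`
(the blockwise dual family is `(-b_τ2, -b_τ3, b_τ0, b_τ1)`). [cite: Hazama1983, §3 (p. 305)]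
[cite: GoodmanWallachGTM255, §4.1.1] [cite: Milne1999LefschetzClasses, p. 654] -/
theorem casimirClass_eq_sum_blocks_darboux_of_characters (hHD : exists_isReal_hodgeModel)
    (ψ : (BettiUniverse.hodge hHD (AbelianVariety.isSmoothProjective_holds (A := A)) 1).Polarization)
    (hself : ∀ a : (BettiUniverse.hodge hHD (AbelianVariety.isSmoothProjective_holds (A := A)) 1).endAlg,
      LinearMap.IsAdjointPair ψ.form ψ.form (a : Module.End ℚ (bettiCohomology A.X 1))
        (a : Module.End ℚ (bettiCohomology A.X 1)))
    {T : Type} [Fintype T] [DecidableEq T]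
    (σ : T → ((BettiUniverse.hodge hHD (AbelianVariety.isSmoothProjective_holds (A := A)) 1).endAlg →+* ℂ)) (hσ : Function.Injective σ)
    (hint : DirectSum.IsInternal fun τ => (BettiUniverse.hodge hHD (AbelianVariety.isSmoothProjective_holds (A := A)) 1).eigenBlock (σ τ))
    (b : ∀ τ : T, Module.Basis (Fin 4) ℂ
      ((BettiUniverse.hodge hHD (AbelianVariety.isSmoothProjective_holds (A := A)) 1).eigenBlock
        (σ τ)))
    (h02 : ∀ τ, ψ.form.baseChange ℂ (b τ 0 : ℂ ⊗[ℚ] bettiCohomology A.X 1) (b τ 2) = 1)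
    (h13 : ∀ τ, ψ.form.baseChange ℂ (b τ 1 : ℂ ⊗[ℚ] bettiCohomology A.X 1) (b τ 3) = 1)
    (h01 : ∀ τ, ψ.form.baseChange ℂ (b τ 0 : ℂ ⊗[ℚ] bettiCohomology A.X 1) (b τ 1) = 0)
    (h23 : ∀ τ, ψ.form.baseChange ℂ (b τ 2 : ℂ ⊗[ℚ] bettiCohomology A.X 1) (b τ 3) = 0)
    (h03 : ∀ τ, ψ.form.baseChange ℂ (b τ 0 : ℂ ⊗[ℚ] bettiCohomology A.X 1) (b τ 3) = 0)
    (h12 : ∀ τ, ψ.form.baseChange ℂ (b τ 1 : ℂ ⊗[ℚ] bettiCohomology A.X 1) (b τ 2) = 0)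
    {ι : Type*} [Fintype ι] [DecidableEq ι] (e : Module.Basis ι ℚ (bettiCohomology A.X 1))
    (Y : Module.End ℂ (ℂ ⊗[ℚ] bettiCohomology A.X 1)) :
    casimirClass A ψ.form ψ.nondegenerate e Y =
      ∑ τ, (cupH1 A (Y (b τ 0)) (b τ 2) - cupH1 A (Y (b τ 2)) (b τ 0) +
        (cupH1 A (Y (b τ 1)) (b τ 3) - cupH1 A (Y (b τ 3)) (b τ 1))) := by
  classical
  have hX : IsSmoothProjective A.dim A.X := AbelianVariety.isSmoothProjective_holds
  have hodd : Odd (((1 : ℕ) : ℤ)) := ⟨0, by norm_num⟩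
  set Ψ := ψ.form.baseChange ℂ with hΨ
  have hself0 : ∀ τ (a : Fin 4), Ψ (b τ a : ℂ ⊗[ℚ] bettiCohomology A.X 1) (b τ a) = 0 := fun τ a =>
    form_baseChange_self_eq_zero_of_odd (BettiUniverse.hodge hHD hX 1) hodd ψ _
  have hswap : ∀ τ (a c : Fin 4), Ψ (b τ c : ℂ ⊗[ℚ] bettiCohomology A.X 1) (b τ a) =
      -Ψ (b τ a : ℂ ⊗[ℚ] bettiCohomology A.X 1) (b τ c) := fun τ a c =>
    form_baseChange_swap_of_odd (BettiUniverse.hodge hHD hX 1) hodd ψ _ _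
  -- the blockwise dual family
  set d : T × Fin 4 → ℂ ⊗[ℚ] bettiCohomology A.X 1 := fun τa =>
    ![-(b τa.1 2 : ℂ ⊗[ℚ] bettiCohomology A.X 1), -(b τa.1 3 : ℂ ⊗[ℚ] bettiCohomology A.X 1),
      (b τa.1 0 : ℂ ⊗[ℚ] bettiCohomology A.X 1), (b τa.1 1 : ℂ ⊗[ℚ] bettiCohomology A.X 1)] τa.2 with hd
  have hd0 : ∀ τ, d (τ, 0) = -(b τ 2 : ℂ ⊗[ℚ] bettiCohomology A.X 1) := fun τ => rfl
  have hd1 : ∀ τ, d (τ, 1) = -(b τ 3 : ℂ ⊗[ℚ] bettiCohomology A.X 1) := fun τ => rfl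
  have hd2 : ∀ τ, d (τ, 2) = (b τ 0 : ℂ ⊗[ℚ] bettiCohomology A.X 1) := fun τ => rfl
  have hd3 : ∀ τ, d (τ, 3) = (b τ 1 : ℂ ⊗[ℚ] bettiCohomology A.X 1) := fun τ => rfl
  have hdT : ∀ τ a, d (τ, a) ∈ (BettiUniverse.hodge hHD hX 1).eigenBlock (σ τ) := by
    intro τ a
    fin_cases a
    · exact Submodule.neg_mem _ (b τ 2).2
    · exact Submodule.neg_mem _ (b τ 3).2
    · exact (b τ 0).2
    · exact (b τ 1).2
  -- the sixteen pairings
  have h20 : ∀ τ, Ψ (b τ 2 : ℂ ⊗[ℚ] bettiCohomology A.X 1) (b τ 0) = -1 := fun τ => by rw [hswap, h02]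
  have h31 : ∀ τ, Ψ (b τ 3 : ℂ ⊗[ℚ] bettiCohomology A.X 1) (b τ 1) = -1 := fun τ => by rw [hswap, h13]
  have h10 : ∀ τ, Ψ (b τ 1 : ℂ ⊗[ℚ] bettiCohomology A.X 1) (b τ 0) = 0 := fun τ => by
    rw [hswap, h01, neg_zero]
  have h32 : ∀ τ, Ψ (b τ 3 : ℂ ⊗[ℚ] bettiCohomology A.X 1) (b τ 2) = 0 := fun τ => by
    rw [hswap, h23, neg_zero]
  have h30 : ∀ τ, Ψ (b τ 3 : ℂ ⊗[ℚ] bettiCohomology A.X 1) (b τ 0) = 0 := fun τ => by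
    rw [hswap, h03, neg_zero]
  have h21 : ∀ τ, Ψ (b τ 2 : ℂ ⊗[ℚ] bettiCohomology A.X 1) (b τ 1) = 0 := fun τ => by
    rw [hswap, h12, neg_zero]
  have hdual : ∀ τ (a c : Fin 4), Ψ (d (τ, a)) (b τ c : ℂ ⊗[ℚ] bettiCohomology A.X 1) =
      if a = c then 1 else 0 := by
    intro τ a c
    fin_cases a <;> fin_cases c <;>
      simp only [Fin.zero_eta, Fin.isValue, Fin.mk_one, Fin.reduceFinMk, hd0, hd1, hd2, hd3, map_neg,
        LinearMap.neg_apply, hself0, h20, h31, h10, h32, h30, h21, h02, h13, h01, h23, h03, h12, neg_neg,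
        neg_zero] <;>
      simp
  rw [casimirClass_eq_sum_dualFamily_of_characters hHD ψ hself σ hσ hint b d hdT hdual e Y]
  refine Finset.sum_congr rfl fun τ _ => ?_
  rw [Fin.sum_univ_four, hd0, hd1, hd2, hd3]
  simp only [map_neg, LinearMap.neg_apply]
  abel

/-- **An operator acting on every block `V_τ` by a scalar lies in `End_Hdg(H¹) ⊗ ℂ`** (it commutes with
`Lie Hdg ⊗ ℂ ∋ Θ`, whose elements preserve the blocks; `ThetaSubalgebra.mem_span_endAlg_of_forall_commute`).
Hazama 1983 §3: the projections `p_i` onto the `V_i` come from `End⁰(A) ⊗ ℂ`. [cite: Hazama1983, §3 (p. 305)] -/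
theorem blockScalar_mem_span_endAlg_of_characters [HodgeTensorFacts.{0, 0}] [Module.Finite ℚ (bettiCohomology A.X 1)]
    (hHD : exists_isReal_hodgeModel)
    {T : Type} [Fintype T] [DecidableEq T]
    (σ : T → ((BettiUniverse.hodge hHD (AbelianVariety.isSmoothProjective_holds (A := A)) 1).endAlg →+* ℂ))
    (hint : DirectSum.IsInternal fun τ => (BettiUniverse.hodge hHD (AbelianVariety.isSmoothProjective_holds (A := A)) 1).eigenBlock (σ τ)) {m : ℕ}
    (b : ∀ τ : T, Module.Basis (Fin m) ℂ
      ((BettiUniverse.hodge hHD (AbelianVariety.isSmoothProjective_holds (A := A)) 1).eigenBlock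
        (σ τ)))
    (c : T → ℂ) {P : Module.End ℂ (ℂ ⊗[ℚ] bettiCohomology A.X 1)}
    (hPb : ∀ τ (x : ℂ ⊗[ℚ] bettiCohomology A.X 1),
      x ∈ (BettiUniverse.hodge hHD (AbelianVariety.isSmoothProjective_holds (A := A)) 1).eigenBlock
        (σ τ) → P x = c τ • x) :
    P ∈ Submodule.span ℂ ((fun a : Module.End ℚ (bettiCohomology A.X 1) => a.baseChange ℂ) ''
      ((BettiUniverse.hodge hHD (AbelianVariety.isSmoothProjective_holds (A := A)) 1).endAlg :
        Set (Module.End ℚ (bettiCohomology A.X 1)))) := by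
  classical
  have hX : IsSmoothProjective A.dim A.X := AbelianVariety.isSmoothProjective_holds
  have _hb := b
  obtain ⟨Θ, hΘ⟩ := exists_hodgeTheta (BettiUniverse.hodge hHD hX 1)
  have hΘC : Θ ∈ spanC (BettiUniverse.hodge hHD hX 1).hodgeLie := by
    rw [← hodgeLieC_eq_spanC]; exact (BettiUniverse.hodge hHD hX 1).mem_hodgeLieC_of_forall_piece hΘ
  refine ThetaSubalgebra.mem_span_endAlg_of_forall_commute (BettiUniverse.hodge hHD hX 1)
    (BettiUniverse.hodge hHD hX 1).hodgeLie hΘ hΘC fun X hXm => ?_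
  have hXT : ∀ τ', Set.MapsTo (X.baseChange ℂ)
      ((BettiUniverse.hodge hHD hX 1).eigenBlock (σ τ'))
      ((BettiUniverse.hodge hHD hX 1).eigenBlock (σ τ')) :=
    mapsTo_of_mem_hodgeLieC (BettiUniverse.hodge hHD hX 1) σ (baseChange_mem_spanC hXm)
  refine LinearMap.ext fun x => ?_
  have hx : x ∈ ⨆ τ', (BettiUniverse.hodge hHD hX 1).eigenBlock (σ τ') := by
    rw [hint.submodule_iSup_eq_top]; exact Submodule.mem_top
  induction hx using Submodule.iSup_induction' with
  | mem τ' x hx =>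
    rw [Module.End.mul_apply, Module.End.mul_apply, hPb τ' x hx, hPb τ' _ (hXT τ' hx), map_smul]
  | zero => simp
  | add x x' _ _ hx hx' => rw [map_add, map_add, hx, hx']

open scoped Classical in
/-- **The block projectors exist**: for every place `τ` an operator `P_τ` of `H¹ ⊗ ℂ` acting by `[τ' = τ]` on
`V_{τ'}` (defined on the collected block basis). [cite: Hazama1983, §3 (p. 305)] -/
theorem exists_blockProjector_of_characters (hHD : exists_isReal_hodgeModel)
    {T : Type} [Fintype T] [DecidableEq T]
    (σ : T → ((BettiUniverse.hodge hHD (AbelianVariety.isSmoothProjective_holds (A := A)) 1).endAlg →+* ℂ))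
    (hint : DirectSum.IsInternal fun τ => (BettiUniverse.hodge hHD (AbelianVariety.isSmoothProjective_holds (A := A)) 1).eigenBlock (σ τ))
    {m : ℕ} (b : ∀ τ : T, Module.Basis (Fin m) ℂ
      ((BettiUniverse.hodge hHD (AbelianVariety.isSmoothProjective_holds (A := A)) 1).eigenBlock
        (σ τ)))
    (τ : T) :
    ∃ P : Module.End ℂ (ℂ ⊗[ℚ] bettiCohomology A.X 1), ∀ τ' (x : ℂ ⊗[ℚ] bettiCohomology A.X 1),
      x ∈ (BettiUniverse.hodge hHD (AbelianVariety.isSmoothProjective_holds (A := A)) 1).eigenBlock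
        (σ τ') → P x = (if τ' = τ then (1 : ℂ) else 0) • x := by
  classical
  haveI : Module.Finite ℚ (bettiCohomology A.X 1) := finite_bettiCohomology_one A
  set cb := hint.collectedBasis b with hcb
  have hcb_apply : ∀ τ' c, cb ⟨τ', c⟩ = (b τ' c : ℂ ⊗[ℚ] bettiCohomology A.X 1) := fun τ' c => by
    rw [hcb, DirectSum.IsInternal.collectedBasis_coe]
  set P : Module.End ℂ (ℂ ⊗[ℚ] bettiCohomology A.X 1) := cb.constr ℂ fun j : Σ _ : T, Fin m =>
    if j.1 = τ then (b j.1 j.2 : ℂ ⊗[ℚ] bettiCohomology A.X 1) else 0 with hP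
  have hPbasis : ∀ τ' c, P (b τ' c : ℂ ⊗[ℚ] bettiCohomology A.X 1) =
      (if τ' = τ then (1 : ℂ) else 0) • (b τ' c : ℂ ⊗[ℚ] bettiCohomology A.X 1) := by
    intro τ' c
    rw [← hcb_apply, hP, Module.Basis.constr_basis]
    by_cases h : τ' = τ
    · rw [if_pos h, if_pos h, one_smul, hcb_apply]
    · rw [if_neg h, if_neg h, zero_smul]
  refine ⟨P, fun τ' x hx => ?_⟩
  have hx' : x = ∑ c, (b τ').repr ⟨x, hx⟩ c • (b τ' c : ℂ ⊗[ℚ] bettiCohomology A.X 1) := by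
    conv_lhs => rw [show x = ((⟨x, hx⟩ : (BettiUniverse.hodge hHD
      (AbelianVariety.isSmoothProjective_holds (A := A)) 1).eigenBlock (σ τ')) : _)
      from rfl, ← (b τ').sum_repr ⟨x, hx⟩]
    simp only [Submodule.coe_sum, Submodule.coe_smul]
  rw [hx', map_sum, Finset.smul_sum]
  refine Finset.sum_congr rfl fun c _ => ?_
  rw [map_smul, hPbasis, smul_comm]

/-- **Theorem (`ρ(b_τ 0) ⌣ ρ(b_τ 2) + ρ(b_τ 1) ⌣ ρ(b_τ 3) ∈ B¹(A) ⊗ ℂ`; Murty 1984 §3 / Milne 1999 Prop. 3.6 (a),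
p. 654: the symplectic form `ω_τ ∈ Λ² V_τ` of each factor is a divisor class).** For `A` with `End⁰(A)` a
totally real field, a polarization `ψ` of `H¹(A(ℂ); ℚ)` and Hodge–Darboux block bases `b_τ` of the eigenblocks,
the class `θ_τ = ρ(b_τ 0) ⌣ ρ(b_τ 2) + ρ(b_τ 1) ⌣ ρ(b_τ 3) ∈ H²(A(ℂ); ℂ)` is a `ℂ`-combination of RATIONAL
`(1,1)`-classes: `2 θ_τ = Λ(p_τ) ∈ span_ℂ {Λ(a ⊗ 1) : a ∈ End_Hdg}` (`p_τ` the block projector,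
`blockScalar_mem_span_endAlg`), each `Λ(a ⊗ 1)` is rational (`isRationalClass_casimirClass_baseChange`) and of
type `(1,1)` (`casimirClass_eq_sum_blocks_darboux`: `a` is the scalar `τ(a)` on `V_τ`, the kinds of
`(b_τ0, b_τ2)`, `(b_τ1, b_τ3)` are `(1,0), (0,1)`). [cite: Murty1984, §3] [cite: Milne1999LefschetzClasses, §3 Prop. 3.6 (a) and p. 654]
[cite: Ribet1983, Thm. 0] [cite: Hazama1983, §3 (pp. 305–306)] -/
theorem thetaFour_mem_span_rational_oneOne_of_characters [HodgeTensorFacts.{0, 0}] (hHD : exists_isReal_hodgeModel)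
    (hI : hodgePQ_independent_of_hodgeModel)
    (ψ : (BettiUniverse.hodge hHD (AbelianVariety.isSmoothProjective_holds (A := A)) 1).Polarization)
    (hself : ∀ a : (BettiUniverse.hodge hHD (AbelianVariety.isSmoothProjective_holds (A := A)) 1).endAlg,
      LinearMap.IsAdjointPair ψ.form ψ.form (a : Module.End ℚ (bettiCohomology A.X 1))
        (a : Module.End ℚ (bettiCohomology A.X 1)))
    {T : Type} [Fintype T] [DecidableEq T]
    (σ : T → ((BettiUniverse.hodge hHD (AbelianVariety.isSmoothProjective_holds (A := A)) 1).endAlg →+* ℂ)) (hσ : Function.Injective σ)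
    (hint : DirectSum.IsInternal fun τ => (BettiUniverse.hodge hHD (AbelianVariety.isSmoothProjective_holds (A := A)) 1).eigenBlock (σ τ))
    (b : ∀ τ : T, Module.Basis (Fin 4) ℂ
      ((BettiUniverse.hodge hHD (AbelianVariety.isSmoothProjective_holds (A := A)) 1).eigenBlock
        (σ τ)))
    (hb0 : ∀ τ, (b τ 0 : ℂ ⊗[ℚ] bettiCohomology A.X 1) ∈
      (BettiUniverse.hodge hHD (AbelianVariety.isSmoothProjective_holds (A := A)) 1).piece 1 0)
    (hb1 : ∀ τ, (b τ 1 : ℂ ⊗[ℚ] bettiCohomology A.X 1) ∈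
      (BettiUniverse.hodge hHD (AbelianVariety.isSmoothProjective_holds (A := A)) 1).piece 1 0)
    (hb2 : ∀ τ, (b τ 2 : ℂ ⊗[ℚ] bettiCohomology A.X 1) ∈
      (BettiUniverse.hodge hHD (AbelianVariety.isSmoothProjective_holds (A := A)) 1).piece 0 1)
    (hb3 : ∀ τ, (b τ 3 : ℂ ⊗[ℚ] bettiCohomology A.X 1) ∈
      (BettiUniverse.hodge hHD (AbelianVariety.isSmoothProjective_holds (A := A)) 1).piece 0 1)
    (h02 : ∀ τ, ψ.form.baseChange ℂ (b τ 0 : ℂ ⊗[ℚ] bettiCohomology A.X 1) (b τ 2) = 1)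
    (h13 : ∀ τ, ψ.form.baseChange ℂ (b τ 1 : ℂ ⊗[ℚ] bettiCohomology A.X 1) (b τ 3) = 1)
    (h01 : ∀ τ, ψ.form.baseChange ℂ (b τ 0 : ℂ ⊗[ℚ] bettiCohomology A.X 1) (b τ 1) = 0)
    (h23 : ∀ τ, ψ.form.baseChange ℂ (b τ 2 : ℂ ⊗[ℚ] bettiCohomology A.X 1) (b τ 3) = 0)
    (h03 : ∀ τ, ψ.form.baseChange ℂ (b τ 0 : ℂ ⊗[ℚ] bettiCohomology A.X 1) (b τ 3) = 0)
    (h12 : ∀ τ, ψ.form.baseChange ℂ (b τ 1 : ℂ ⊗[ℚ] bettiCohomology A.X 1) (b τ 2) = 0)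
    (τ : T) :
    cupH1 A (b τ 0 : ℂ ⊗[ℚ] bettiCohomology A.X 1) (b τ 2) + cupH1 A (b τ 1 : ℂ ⊗[ℚ] bettiCohomology A.X 1) (b τ 3) ∈
      Submodule.span ℂ {c : complexBetti A.X 2 | IsRationalClass c ∧ IsOfHodgeType A.dim A.X 2 1 1 c} := by
  classical
  have hX : IsSmoothProjective A.dim A.X := AbelianVariety.isSmoothProjective_holds
  haveI : Module.Finite ℚ (bettiCohomology A.X 1) := finite_bettiCohomology_one A
  set e := Module.finBasis ℚ (bettiCohomology A.X 1) with he
  set Λ := casimirClass A ψ.form ψ.nondegenerate e with hΛ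
  set S := Submodule.span ℂ
    {c : complexBetti A.X 2 | IsRationalClass c ∧ IsOfHodgeType A.dim A.X 2 1 1 c} with hS
  -- Hodge types of the block letters and of their cup products
  have ht10 : ∀ (x : ℂ ⊗[ℚ] bettiCohomology A.X 1), x ∈ (BettiUniverse.hodge hHD hX 1).piece 1 0 →
      IsOfHodgeType A.dim A.X 1 1 0 (ofRatClassBaseChange (Motives.ComplexPoints A.X) 1 x) :=
    fun x hx => (BettiUniverse.mem_hodge_piece_iff hHD hI hX (k := 1) (p := 1) (q := 0) rfl _).1 hx
  have ht01 : ∀ (x : ℂ ⊗[ℚ] bettiCohomology A.X 1), x ∈ (BettiUniverse.hodge hHD hX 1).piece 0 1 →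
      IsOfHodgeType A.dim A.X 1 0 1 (ofRatClassBaseChange (Motives.ComplexPoints A.X) 1 x) :=
    fun x hx => (BettiUniverse.mem_hodge_piece_iff hHD hI hX (k := 1) (p := 0) (q := 1) rfl _).1 hx
  have hcup := BettiUniverse.cupPreservesHodgeType hHD hI hX
  have hPQ : ∀ (x y : ℂ ⊗[ℚ] bettiCohomology A.X 1), x ∈ (BettiUniverse.hodge hHD hX 1).piece 1 0 →
      y ∈ (BettiUniverse.hodge hHD hX 1).piece 0 1 → IsOfHodgeType A.dim A.X 2 1 1 (cupH1 A x y) := by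
    intro x y hx hy
    have h : IsOfHodgeType A.dim A.X 2 (1 + 0) (0 + 1) _ := hcup (rfl : 1 + 1 = 2) (ht10 x hx) (ht01 y hy)
    rw [cupH1_apply]
    exact h
  have hQP : ∀ (x y : ℂ ⊗[ℚ] bettiCohomology A.X 1), x ∈ (BettiUniverse.hodge hHD hX 1).piece 0 1 →
      y ∈ (BettiUniverse.hodge hHD hX 1).piece 1 0 → IsOfHodgeType A.dim A.X 2 1 1 (cupH1 A x y) := by
    intro x y hx hy
    have h : IsOfHodgeType A.dim A.X 2 (0 + 1) (1 + 0) _ := hcup (rfl : 1 + 1 = 2) (ht01 x hx) (ht10 y hy)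
    rw [cupH1_apply]
    exact h
  -- (1) `Λ(a ⊗ 1) ∈ S` for `a ∈ End_Hdg`
  have hΛa : ∀ a : (BettiUniverse.hodge hHD hX 1).endAlg,
      Λ ((a : Module.End ℚ (bettiCohomology A.X 1)).baseChange ℂ) ∈ S := by
    intro a
    refine Submodule.subset_span ⟨isRationalClass_casimirClass_baseChange ψ.form ψ.nondegenerate e _, ?_⟩
    rw [hΛ, casimirClass_eq_sum_blocks_darboux_of_characters hHD ψ hself σ hσ hint b h02 h13 h01 h23 h03 h12 e]
    obtain ⟨M⟩ := nonempty_hodgeModel_holds hX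
    refine IsOfHodgeType.sum hX M _ _ fun τ' _ => ?_
    have ha : ∀ r, (a : Module.End ℚ (bettiCohomology A.X 1)).baseChange ℂ
        (b τ' r : ℂ ⊗[ℚ] bettiCohomology A.X 1) = σ τ' a • (b τ' r : _) :=
      fun r => ((BettiUniverse.hodge hHD hX 1).mem_eigenBlock_iff _ _).1 (b τ' r).2 a
    rw [ha, ha, ha, ha, map_smul, LinearMap.smul_apply, map_smul, LinearMap.smul_apply, map_smul,
      LinearMap.smul_apply, map_smul, LinearMap.smul_apply]
    exact IsOfHodgeType.add hX
      (IsOfHodgeType.sub hX ((hPQ _ _ (hb0 τ') (hb2 τ')).smul _) ((hQP _ _ (hb2 τ') (hb0 τ')).smul _))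
      (IsOfHodgeType.sub hX ((hPQ _ _ (hb1 τ') (hb3 τ')).smul _) ((hQP _ _ (hb3 τ') (hb1 τ')).smul _))
  -- (2) the block projector `P_τ ∈ End_Hdg ⊗ ℂ`, so `Λ(P_τ) ∈ S`
  obtain ⟨P, hPb⟩ := exists_blockProjector_of_characters hHD σ hint b τ
  have hΛP : Λ P ∈ S := by
    have hPmem := blockScalar_mem_span_endAlg_of_characters hHD σ hint b (fun τ' => if τ' = τ then (1 : ℂ) else 0) hPb
    have hle : Submodule.span ℂ ((fun a : Module.End ℚ (bettiCohomology A.X 1) => a.baseChange ℂ) ''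
        ((BettiUniverse.hodge hHD hX 1).endAlg : Set (Module.End ℚ (bettiCohomology A.X 1)))) ≤ S.comap Λ := by
      refine Submodule.span_le.2 ?_
      rintro _ ⟨a, ha, rfl⟩
      exact hΛa ⟨a, ha⟩
    exact hle hPmem
  -- (3) `Λ(P_τ) = 2 θ_τ`
  have hPb' : ∀ τ' (r : Fin 4), P (b τ' r : ℂ ⊗[ℚ] bettiCohomology A.X 1) =
      (if τ' = τ then (1 : ℂ) else 0) • (b τ' r : _) := fun τ' r => hPb τ' _ (b τ' r).2
  have hgc : ∀ x y : ℂ ⊗[ℚ] bettiCohomology A.X 1, cupH1 A y x = -cupH1 A x y := fun x y => by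
    rw [cupH1_apply, cupH1_apply, cupProduct_gradedComm_holds ℂ (Motives.ComplexPoints A.X)
      (rfl : 1 + 1 = 2) (rfl : 1 + 1 = 2)]
    norm_num
  have hΛPeq : Λ P = (2 : ℂ) • (cupH1 A (b τ 0 : ℂ ⊗[ℚ] bettiCohomology A.X 1) (b τ 2) +
      cupH1 A (b τ 1 : ℂ ⊗[ℚ] bettiCohomology A.X 1) (b τ 3)) := by
    rw [hΛ, casimirClass_eq_sum_blocks_darboux_of_characters hHD ψ hself σ hσ hint b h02 h13 h01 h23 h03 h12 e, Finset.sum_eq_single τ]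
    · rw [hPb', hPb', hPb', hPb', if_pos rfl, one_smul, one_smul, one_smul, one_smul,
        hgc (b τ 0 : ℂ ⊗[ℚ] bettiCohomology A.X 1) (b τ 2), hgc (b τ 1 : ℂ ⊗[ℚ] bettiCohomology A.X 1) (b τ 3),
        sub_neg_eq_add, sub_neg_eq_add, two_smul]
      abel
    · intro τ' _ hτ'
      rw [hPb', hPb', hPb', hPb', if_neg hτ', zero_smul, zero_smul, zero_smul, zero_smul, LinearMap.map_zero₂,
        LinearMap.map_zero₂, LinearMap.map_zero₂, LinearMap.map_zero₂]
      simp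
    · intro h; exact absurd (Finset.mem_univ τ) h
  have h := S.smul_mem (2 : ℂ)⁻¹ hΛP
  rwa [hΛPeq, smul_smul, inv_mul_cancel₀ (two_ne_zero' ℂ), one_smul] at h

end Characters

/-! ### §2 The notion and its consequences -/

section Data

variable {A B : AbelianVariety ℂ} {n : ℕ} {g : Fin n → (B ⟶ A)}

/-- **Real `𝔰𝔭₄`-block data on `H¹(A)`** (the abstract input of Moonen–Zarhin's Type I(2) / Murty's argument, in the
form stable under orthogonal products): `End⁰(A)` is commutative, and there are finitely many characters
`τ_i : End⁰(A) → ℂ`, all REAL (`conj ∘ τ_i = τ_i`), whose joint eigenspaces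
`V_i = ⋂_e ker(e^* ⊗ ℂ − τ_i(e))` on `H¹(A(ℂ); ℚ) ⊗ ℂ` form an internal direct sum with `dim_ℂ V_i = 4`
(«`H¹(A, ℂ) = V₁ ⊕ ⋯ ⊕ V_k`», Hazama p. 305, with four-dimensional blocks: Moonen–Zarhin Type I(2), `U_σ` of dimension
`r = 2 dim A/[F:ℚ] = 4` in Ribet's proof of Thm. 0). The rank-four twin of `HasRealSl2Blocks`.
[cite: MoonenZarhin1995Duke, Type I(2)] [cite: Hazama1983, §3 (pp. 305–306)] [cite: Ribet1983, Thm. 0] -/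
def HasRealSp4Blocks (A : AbelianVariety ℂ) : Prop :=
  (∀ x y : A.endAlgebra, x * y = y * x) ∧
  ∃ (ι : Type) (_ : Fintype ι) (_ : DecidableEq ι) (τ : ι → (A.endAlgebra →+* ℂ)),
    (∀ i, (starRingEnd ℂ).comp (τ i) = τ i) ∧
    DirectSum.IsInternal (fun i => (⨅ e : A.endAlgebra,
      Module.End.eigenspace ((MulOpposite.unop (bettiRep A e)).baseChange ℂ) (τ i e) : Submodule ℂ _)) ∧
    ∀ i, Module.finrank ℂ (⨅ e : A.endAlgebra,
      Module.End.eigenspace ((MulOpposite.unop (bettiRep A e)).baseChange ℂ) (τ i e) : Submodule ℂ _) = 4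

/-- `End⁰(A)` is commutative when `A` has real `𝔰𝔭₄`-block data. [cite: Hazama1983, §3 (pp. 305–306)] -/
theorem HasRealSp4Blocks.comm (h : HasRealSp4Blocks A) : ∀ x y : A.endAlgebra, x * y = y * x := h.1

/-- Distinct blocks of an internal direct sum with non-zero blocks have distinct characters. [folklore] -/
private theorem injective_of_isInternal_eigenBlock_four {V : Type} [AddCommGroup V] [Module ℚ V] {m : ℕ}
    (H : Literature.AlgebraicGeometry.Motives.HodgeStructure V m) {ι : Type} [DecidableEq ι] (σ : ι → (H.endAlg →+* ℂ))
    (hint : DirectSum.IsInternal fun i => H.eigenBlock (σ i))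
    (h4 : ∀ i, Module.finrank ℂ (H.eigenBlock (σ i)) = 4) : Function.Injective σ := by
  intro k k' hkk'
  by_contra hne
  have hbot : H.eigenBlock (σ k) = ⊥ := by
    have h := hint.submodule_iSupIndep.pairwiseDisjoint hne
    change Disjoint (H.eigenBlock (σ k)) (H.eigenBlock (σ k')) at h
    rw [← hkk'] at h
    exact disjoint_self.1 h
  have h0 := h4 k
  rw [hbot, finrank_bot] at h0
  exact absurd h0 (by norm_num)

/-- **`B• = D• ⊗ ℂ` for every abelian variety with slots over an `A` with real `𝔰𝔭₄`-block data** (Riemann +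
automatic self-adjointness + Hodge–Darboux block bases + the symplectic classes of §1 + the invariance theorem and the
coloured symplectic first fundamental theorem, `AVSlots.isDivisorGenerated_of_sp4BlockBasis`, all in the tree).
[cite: MoonenZarhin1995Duke, Type I(2)] [cite: Murty1984, §3] [cite: Ribet1983, Thm. 0] [cite: MoonenZarhin1999LowDim, §3 Thm. (3.2)(1)] -/
theorem HasRealSp4Blocks.isDivisorGenerated_of_avSlots (h : HasRealSp4Blocks A) (hg : AVSlots A B g) :
    IsDivisorGenerated B := by
  classical
  obtain ⟨hc, ι, _, _, τ, hreal, hint, h4⟩ := h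
  have hHD : exists_isReal_hodgeModel := exists_isReal_hodgeModel_holds
  have hI : hodgePQ_independent_of_hodgeModel := hodgePQ_independent_of_hodgeModel_holds
  haveI : HodgeTensorFacts.{0, 0} := hodgeTensorFacts_holds.{0, 0}
  haveI : Module.Finite ℚ (bettiCohomology A.X 1) := finite_bettiCohomology_one A
  have hX : IsSmoothProjective A.dim A.X := AbelianVariety.isSmoothProjective_holds
  obtain ⟨ψ⟩ : (BettiUniverse.hodge hHD (AbelianVariety.isSmoothProjective_holds (A := A)) 1).IsPolarizable :=
    smoothProjective_hodgeStructure_isPolarizable_holds hX (BettiUniverse.realHodgeModel hHD hX)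
      (BettiUniverse.realHodgeModel_isHodgeSymmetric hHD hX) 1
  have heff : (BettiUniverse.hodge hHD hX 1).IsEffective := BettiUniverse.hodge_isEffective hHD hX 1
  -- the characters of `End_Hdg`
  set Φ := endAlgebraAlgEquivEndAlgOfComm hc hHD hI with hΦ
  have heq : ∀ i, (BettiUniverse.hodge hHD (AbelianVariety.isSmoothProjective_holds (A := A)) 1).eigenBlock
      ((τ i).comp Φ.symm.toRingEquiv.toRingHom) =
      ⨅ e : A.endAlgebra, Module.End.eigenspace ((MulOpposite.unop (bettiRep A e)).baseChange ℂ) (τ i e) :=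
    fun i => eigenBlock_comp_endAlgebraAlgEquivEndAlgOfComm_symm hc hHD hI (τ i)
  have hreal' : ∀ i, (starRingEnd ℂ).comp ((τ i).comp Φ.symm.toRingEquiv.toRingHom) =
      (τ i).comp Φ.symm.toRingEquiv.toRingHom :=
    fun i => comp_endAlgebraAlgEquivEndAlgOfComm_symm_isReal hc hHD hI (hreal i)
  have hfun : (fun i => (BettiUniverse.hodge hHD (AbelianVariety.isSmoothProjective_holds (A := A)) 1).eigenBlock
      ((τ i).comp Φ.symm.toRingEquiv.toRingHom)) = fun i => (⨅ e : A.endAlgebra,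
        Module.End.eigenspace ((MulOpposite.unop (bettiRep A e)).baseChange ℂ) (τ i e) : Submodule ℂ _) :=
    funext heq
  have hint' : DirectSum.IsInternal fun i =>
      (BettiUniverse.hodge hHD (AbelianVariety.isSmoothProjective_holds (A := A)) 1).eigenBlock
        ((τ i).comp Φ.symm.toRingEquiv.toRingHom) := by
    rw [hfun]; exact hint
  have h4' : ∀ i, Module.finrank ℂ
      ((BettiUniverse.hodge hHD (AbelianVariety.isSmoothProjective_holds (A := A)) 1).eigenBlock
        ((τ i).comp Φ.symm.toRingEquiv.toRingHom)) = 4 := fun i => by rw [heq]; exact h4 i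
  have hself := isAdjointPair_self_of_real_characters
    (BettiUniverse.hodge hHD (AbelianVariety.isSmoothProjective_holds (A := A)) 1) (by norm_num)
    (BettiUniverse.hodge_isEffective hHD hX 1) ψ _ hreal' hint'
  have hσ := injective_of_isInternal_eigenBlock_four (BettiUniverse.hodge hHD (AbelianVariety.isSmoothProjective_holds (A := A)) 1) _ hint' h4'
  -- Hodge–Darboux block bases and their symplectic classes
  obtain ⟨b, hb0, hb1, hb2, hb3, h02, h13, h01, h23, h03, h12⟩ :=
    exists_hodgeDarboux_blockBasis_four (BettiUniverse.hodge hHD hX 1) Nat.cast_one heff ψ hself _ hint' h4'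
  have hθ := thetaFour_mem_span_rational_oneOne_of_characters hHD hI ψ hself _ hσ hint' b hb0 hb1 hb2 hb3 h02 h13
    h01 h23 h03 h12
  exact hg.isDivisorGenerated_of_sp4BlockBasis hHD hI ψ hself _ hreal' hint' h4' b hb0 hb1 hb2 hb3 h02 h13 h01 h23
    h03 h12 hθ

/-- **`B•(A^{N+1}) = D•(A^{N+1}) ⊗ ℂ` for all `N`.** [cite: MoonenZarhin1995Duke, Type I(2)] [cite: Ribet1983, Thm. 0] -/
theorem HasRealSp4Blocks.isDivisorGenerated_powSucc (h : HasRealSp4Blocks A) (N : ℕ) :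
    IsDivisorGenerated (A.powSucc N) :=
  h.isDivisorGenerated_of_avSlots (AVSlots.powSucc A N)

/-- **Condition (D)**: `A` is stably nondegenerate. [cite: MoonenZarhin1999LowDim, §3 Thm. (3.2)(1)]
[cite: Gordon1999HodgeAVSurvey, Thm. 7.5 (1) and Def. 7.6] -/
theorem HasRealSp4Blocks.isStablyNondegenerate (h : HasRealSp4Blocks A) : IsStablyNondegenerate A :=
  (isStablyNondegenerate_iff A).2 h.isDivisorGenerated_powSucc

/-- **The Hodge conjecture for every power `A^{N+1}`**, unconditionally. [cite: MoonenZarhin1995Duke, Type I(2)]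
[cite: MoonenZarhin1999LowDim, §3 Thm. (3.2)(1)] -/
theorem HasRealSp4Blocks.hodgeConjectureFor_powSucc (h : HasRealSp4Blocks A) (N : ℕ) :
    HodgeConjectureFor (A.powSucc N).dim (A.powSucc N).X :=
  hodgeConjectureFor_of_isDivisorGenerated _ (h.isDivisorGenerated_powSucc N)

/-- The Hodge conjecture for everything isogenous to a power of `A`. [cite: vanGeemen1994HodgeAV, Lemma 3.7] -/
theorem HasRealSp4Blocks.hodgeConjectureFor_of_isIsogenous_powSucc (h : HasRealSp4Blocks A)
    {X : AbelianVariety ℂ} {N : ℕ} (hX : X.IsIsogenous (A.powSucc N)) : HodgeConjectureFor X.dim X.X :=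
  HodgeConjectureFor.of_isIsogenous hX (h.hodgeConjectureFor_powSucc N)

/-- **A carrier of real `𝔰𝔭₄`-block data has no factor of type IV** (verbatim `HasRealSl2Blocks.hasNoTypeIVFactor`:
every complex root of the characteristic polynomial of `z^*` is one of the real scalars `τ_i(z)`).
[cite: MoonenZarhin1999LowDim, §1] [cite: Hazama1983, §3 (pp. 305–306)] [cite: Lange2023AbelianVarietiesC, Prop. 1.1.8 and Cor. 2.4.26] -/
theorem HasRealSp4Blocks.hasNoTypeIVFactor (h : HasRealSp4Blocks A) : HasNoTypeIVFactor A := by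
  classical
  obtain ⟨hc, ι, _, _, τ, hreal, hint, -⟩ := h
  haveI : Module.Finite ℚ (bettiCohomology A.X 1) := finite_bettiCohomology_one A
  intro z _
  refine ⟨(MulOpposite.unop (bettiRep A z)).charpoly,
    (LinearMap.charpoly_monic (MulOpposite.unop (bettiRep A z))).ne_zero, ?_, fun x hx => ?_⟩
  · have hinj : Function.Injective (bettiRepOfComm A hc) := fun a b hab => by
      rw [bettiRepOfComm_apply, bettiRepOfComm_apply] at hab
      exact bettiRep_injective (MulOpposite.unop_injective hab)
    apply hinj
    rw [← Polynomial.aeval_algHom_apply, map_zero, bettiRepOfComm_apply]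
    exact LinearMap.aeval_self_charpoly _
  · have hx' : ((MulOpposite.unop (bettiRep A z)).baseChange ℂ).charpoly.IsRoot x := by
      rw [LinearMap.charpoly_baseChange, Polynomial.IsRoot.def, Polynomial.eval_map_algebraMap]
      exact hx
    obtain ⟨v, hv, hv0⟩ :=
      ((Module.End.hasEigenvalue_iff_isRoot_charpoly _ x).2 hx').exists_hasEigenvector
    by_contra hxim
    have hne : ∀ i, τ i z ≠ x := by
      intro i hi
      apply hxim
      rw [← hi]
      have h1 := RingHom.congr_fun (hreal i) z
      rw [RingHom.comp_apply] at h1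
      exact Complex.conj_eq_iff_im.1 h1
    have hle : ∀ i, (⨅ e : A.endAlgebra,
        Module.End.eigenspace ((MulOpposite.unop (bettiRep A e)).baseChange ℂ) (τ i e) : Submodule ℂ _) ≤
        ⨆ (μ : ℂ) (_ : μ ≠ x), Module.End.eigenspace ((MulOpposite.unop (bettiRep A z)).baseChange ℂ) μ :=
      fun i => (iInf_le _ z).trans
        (le_iSup₂_of_le (f := fun μ (_ : μ ≠ x) =>
          Module.End.eigenspace ((MulOpposite.unop (bettiRep A z)).baseChange ℂ) μ) (τ i z) (hne i) le_rfl)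
    have htop : (⊤ : Submodule ℂ (ℂ ⊗[ℚ] bettiCohomology A.X 1)) ≤
        ⨆ (μ : ℂ) (_ : μ ≠ x), Module.End.eigenspace ((MulOpposite.unop (bettiRep A z)).baseChange ℂ) μ := by
      rw [← hint.submodule_iSup_eq_top]
      exact iSup_le hle
    have hdis := Module.End.eigenspaces_iSupIndep ((MulOpposite.unop (bettiRep A z)).baseChange ℂ) x
    exact hv0 ((Submodule.disjoint_def.1 hdis) v hv (htop Submodule.mem_top))

end Data

/-! ### §3 The real-multiplication instance of relative dimension two -/

section RealMultiplication

variable {A : AbelianVariety ℂ}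

/-- A number field has positive degree. [folklore] -/
private theorem finrank_pos_of_numberField₅ (E : Type*) [Field E] [NumberField E] :
    0 < Module.finrank ℚ E := Module.finrank_pos

/-- `0 < dim A` when `2[F:ℚ] = dim A` for the number field `F = End⁰(A)`. [folklore] -/
private theorem dim_pos_of_two_mul_finrank_eq₅ (hF : IsField A.endAlgebra)
    (hdeg : 2 * Module.finrank ℚ A.endAlgebra = A.dim) : 0 < A.dim := by
  have h := finrank_pos_of_numberField₅ (EndField A hF)
  rw [EndField.finrank_eq hF] at h
  omega

/-- `dim V_τ = 4` in the `embCharacter` indexing, when `2[F:ℚ] = dim A`. [cite: MoonenZarhin1995Duke, Type I(2)] -/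
theorem finrank_iInf_eigenspace_embCharacter_eq_four (hF : IsField A.endAlgebra) (hHD : exists_isReal_hodgeModel)
    (hI : hodgePQ_independent_of_hodgeModel) [IsTotallyReal (EndField A hF)]
    (hdeg : 2 * Module.finrank ℚ A.endAlgebra = A.dim) (τ : EndField A hF →+* ℂ) :
    Module.finrank ℂ
      (⨅ e : A.endAlgebra,
        Module.End.eigenspace ((MulOpposite.unop (bettiRep A e)).baseChange ℂ) (embCharacter hF τ e) :
        Submodule ℂ _) = 4 := by
  rw [iInf_eigenspace_embCharacter_eq hF hHD hI]
  exact finrank_eigenBlock_hodgeCharacter_eq_four hF hHD hI hdeg τ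

/-- **An abelian variety whose endomorphism algebra is a totally real field `F` with `2[F:ℚ] = dim A` has real
`𝔰𝔭₄`-block data** (characters = the embeddings `F → ℂ` through `embCharacter`; blocks internal by the tree's
`isInternal_iInf_eigenspace_embCharacter`, of dimension four by `finrank_eigenBlock_hodgeCharacter_eq_four`).
[cite: MoonenZarhin1995Duke, Type I(2)] [cite: Murty1984, §3] [cite: Hazama1983, §3 (pp. 305–306)] -/
theorem hasRealSp4Blocks_of_isTotallyReal_of_two_mul_finrank_eq (A : AbelianVariety ℂ) (hF : IsField A.endAlgebra)
    [IsTotallyReal (EndField A hF)] (hdeg : 2 * Module.finrank ℚ A.endAlgebra = A.dim) : HasRealSp4Blocks A := by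
  classical
  have hHD : exists_isReal_hodgeModel := exists_isReal_hodgeModel_holds
  have hI : hodgePQ_independent_of_hodgeModel := hodgePQ_independent_of_hodgeModel_holds
  exact ⟨hF.mul_comm, EndField A hF →+* ℂ, inferInstance, inferInstance, embCharacter hF, embCharacter_isReal hF,
    isInternal_iInf_eigenspace_embCharacter hF hHD hI, finrank_iInf_eigenspace_embCharacter_eq_four hF hHD hI hdeg⟩

/-- **Isogeny closure of the instance**: `A'` isogenous to such an `A` carries real `𝔰𝔭₄`-block data
(`End⁰(A') ≅ End⁰(A)`, `dim A' = dim A`). [cite: Milne1986AbelianVarieties, §12 p. 122] [cite: MoonenZarhin1995Duke, Type I(2)] -/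
theorem hasRealSp4Blocks_of_isIsogenous_of_isTotallyReal_of_two_mul_finrank_eq {A A' : AbelianVariety ℂ}
    (h : A'.IsIsogenous A) (hF : IsField A.endAlgebra) [IsTotallyReal (EndField A hF)]
    (hdeg : 2 * Module.finrank ℚ A.endAlgebra = A.dim) : HasRealSp4Blocks A' := by
  have hF' : IsField A'.endAlgebra := h.isField_endAlgebra_iff.2 hF
  obtain ⟨e⟩ := h.nonempty_endAlgebra_algEquiv
  haveI : IsTotallyReal (EndField A' hF') :=
    IsTotallyReal.ofRingEquiv (F := EndField A hF)
      (((EndField.toEndAlgebra hF).trans e.symm.toRingEquiv).trans (EndField.toEndAlgebra hF').symm)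
  exact hasRealSp4Blocks_of_isTotallyReal_of_two_mul_finrank_eq A' hF'
    (by rw [h.finrank_endAlgebra_eq, hdeg, AbelianVariety.dim_eq_of_isIsogenous_holds h])

end RealMultiplication

/-! ### §4 Orthogonal products -/

section Products

variable {A B : AbelianVariety ℂ}

/-- **Real `𝔰𝔭₄`-block data is stable under orthogonal products** (Moonen–Zarhin Thm. (3.2)(1) = Hazama 1989 for
this class: `X₁ × X₂` again satisfies (D) when `Hom(X₁, X₂) = 0`): the characters of `End⁰(A × B)` are the
`τ ∘ corner_i`, their blocks the `pr_i^* V_τ` (`HOneOfProductEndomorphismBlocks`), of the same dimension four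
(verbatim `HasRealSl2Blocks.prod` without the basis transport). [cite: MoonenZarhin1999LowDim, §3 Thm. (3.2)(1)]
[cite: Hazama1989, Thm. (= Gordon 7.6.2)] [cite: Hazama1983, §3 (pp. 305–306)] -/
theorem HasRealSp4Blocks.prod (hA : HasRealSp4Blocks A) (hB : HasRealSp4Blocks B) (hAB : ∀ f : A ⟶ B, f = 0)
    (hBA : ∀ g : B ⟶ A, g = 0) : HasRealSp4Blocks (A.prod B) := by
  classical
  obtain ⟨hcA, ι₁, _, _, τ₁, hreal₁, hint₁, h4₁⟩ := hA
  obtain ⟨hcB, ι₂, _, _, τ₂, hreal₂, hint₂, h4₂⟩ := hB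
  have hHD : exists_isReal_hodgeModel := exists_isReal_hodgeModel_holds
  have hI : hodgePQ_independent_of_hodgeModel := hodgePQ_independent_of_hodgeModel_holds
  have hc := endAlgebra_prod_comm_of_orthogonal hcA hcB hAB hBA
  -- the blocks of the product characters are the transported blocks
  have hblk₁ : ∀ i, (⨅ e : (A.prod B).endAlgebra, Module.End.eigenspace
      ((MulOpposite.unop (bettiRep (A.prod B) e)).baseChange ℂ)
        (((τ₁ i).comp (HOneProduct.fstAlgRingHom A B hc)) e) : Submodule ℂ _) =
      (⨅ e : A.endAlgebra, Module.End.eigenspace ((MulOpposite.unop (bettiRep A e)).baseChange ℂ) (τ₁ i e) :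
        Submodule ℂ _).map ((HOneProduct.pullFst A B).baseChange ℂ) := by
    intro i
    rw [← eigenBlock_comp_endAlgebraAlgEquivEndAlgOfComm_symm hc hHD hI]
    exact HOneProduct.eigenBlock_prodFstCharacter hHD hI hc (τ₁ i)
  have hblk₂ : ∀ j, (⨅ e : (A.prod B).endAlgebra, Module.End.eigenspace
      ((MulOpposite.unop (bettiRep (A.prod B) e)).baseChange ℂ)
        (((τ₂ j).comp (HOneProduct.sndAlgRingHom A B hc)) e) : Submodule ℂ _) =
      (⨅ e : B.endAlgebra, Module.End.eigenspace ((MulOpposite.unop (bettiRep B e)).baseChange ℂ) (τ₂ j e) :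
        Submodule ℂ _).map ((HOneProduct.pullSnd A B).baseChange ℂ) := by
    intro j
    rw [← eigenBlock_comp_endAlgebraAlgEquivEndAlgOfComm_symm hc hHD hI]
    exact HOneProduct.eigenBlock_prodSndCharacter hHD hI hc (τ₂ j)
  -- the family of characters
  let τ : ι₁ ⊕ ι₂ → ((A.prod B).endAlgebra →+* ℂ) :=
    Sum.elim (fun i => (τ₁ i).comp (HOneProduct.fstAlgRingHom A B hc))
      (fun j => (τ₂ j).comp (HOneProduct.sndAlgRingHom A B hc))
  have hτl : ∀ i, τ (Sum.inl i) = (τ₁ i).comp (HOneProduct.fstAlgRingHom A B hc) := fun i => rfl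
  have hτr : ∀ j, τ (Sum.inr j) = (τ₂ j).comp (HOneProduct.sndAlgRingHom A B hc) := fun j => rfl
  have hfun : (fun k => (⨅ e : (A.prod B).endAlgebra, Module.End.eigenspace
      ((MulOpposite.unop (bettiRep (A.prod B) e)).baseChange ℂ) (τ k e) : Submodule ℂ _)) =
      Sum.elim
        (fun i => (⨅ e : A.endAlgebra,
          Module.End.eigenspace ((MulOpposite.unop (bettiRep A e)).baseChange ℂ) (τ₁ i e) : Submodule ℂ _).map
            ((HOneProduct.pullFst A B).baseChange ℂ))
        (fun j => (⨅ e : B.endAlgebra,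
          Module.End.eigenspace ((MulOpposite.unop (bettiRep B e)).baseChange ℂ) (τ₂ j e) : Submodule ℂ _).map
            ((HOneProduct.pullSnd A B).baseChange ℂ)) := by
    funext k
    cases k with
    | inl i => rw [Sum.elim_inl, hτl, hblk₁]
    | inr j => rw [Sum.elim_inr, hτr, hblk₂]
  refine ⟨hc, ι₁ ⊕ ι₂, inferInstance, inferInstance, τ, ?_, ?_, ?_⟩
  · rintro (i | j)
    · rw [hτl, ← RingHom.comp_assoc, hreal₁ i]
    · rw [hτr, ← RingHom.comp_assoc, hreal₂ j]
  · rw [hfun]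
    exact HOneProduct.isInternal_sum_elim_map ((HOneProduct.pullFst A B).baseChange ℂ)
      ((HOneProduct.pullSnd A B).baseChange ℂ) ((HOneProduct.pullInl A B).baseChange ℂ)
      ((HOneProduct.pullInr A B).baseChange ℂ) HOneProduct.pullInl_pullFst_baseChange
      HOneProduct.pullInl_pullSnd_baseChange HOneProduct.pullInr_pullSnd_baseChange
      HOneProduct.pullInr_pullFst_baseChange HOneProduct.pullFst_pullInl_add_baseChange hint₁ hint₂
  · rintro (i | j)
    · rw [hτl, hblk₁, ← h4₁ i]
      exact (Submodule.equivMapOfInjective _ HOneProduct.pullFst_baseChange_injective _).finrank_eq.symm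
    · rw [hτr, hblk₂, ← h4₂ j]
      exact (Submodule.equivMapOfInjective _ HOneProduct.pullSnd_baseChange_injective _).finrank_eq.symm

/-- **Three pairwise orthogonal factors** (any number by iteration). [cite: MoonenZarhin1999LowDim, §3 Thm. (3.2)(1)] -/
theorem HasRealSp4Blocks.prod₃ {A₁ A₂ A₃ : AbelianVariety ℂ} (h₁ : HasRealSp4Blocks A₁) (h₂ : HasRealSp4Blocks A₂)
    (h₃ : HasRealSp4Blocks A₃) (h₁₂ : ∀ f : A₁ ⟶ A₂, f = 0) (h₂₁ : ∀ f : A₂ ⟶ A₁, f = 0)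
    (h₁₃ : ∀ f : A₁ ⟶ A₃, f = 0) (h₃₁ : ∀ f : A₃ ⟶ A₁, f = 0) (h₂₃ : ∀ f : A₂ ⟶ A₃, f = 0)
    (h₃₂ : ∀ f : A₃ ⟶ A₂, f = 0) : HasRealSp4Blocks ((A₁.prod A₂).prod A₃) :=
  (h₁.prod h₂ h₁₂ h₂₁).prod h₃ (hom_prod_eq_zero_of_orthogonal h₁₃ h₂₃)
    (hom_to_prod_eq_zero_of_orthogonal h₃₁ h₃₂)

/-- **Condition (D) for `A × B`** («`X₁ × X₂` again satisfies (D)»). [cite: MoonenZarhin1999LowDim, §3 Thm. (3.2)(1)]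
[cite: Hazama1989, Thm. (= Gordon 7.6.2)] -/
theorem HasRealSp4Blocks.isStablyNondegenerate_prod (hA : HasRealSp4Blocks A) (hB : HasRealSp4Blocks B)
    (hAB : ∀ f : A ⟶ B, f = 0) (hBA : ∀ g : B ⟶ A, g = 0) : IsStablyNondegenerate (A.prod B) :=
  (hA.prod hB hAB hBA).isStablyNondegenerate

/-- **`B = D` for every `B'` with slots over `A × B`** (in particular every `(A × B)^{N+1}`).
[cite: MoonenZarhin1999LowDim, §3 Thm. (3.2)(1)] [cite: MoonenZarhin1995Duke, Type I(2)] -/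
theorem HasRealSp4Blocks.isDivisorGenerated_of_avSlots_prod (hA : HasRealSp4Blocks A) (hB : HasRealSp4Blocks B)
    (hAB : ∀ f : A ⟶ B, f = 0) (hBA : ∀ g : B ⟶ A, g = 0) {B' : AbelianVariety ℂ} {n : ℕ}
    {g : Fin n → (B' ⟶ A.prod B)} (hg : AVSlots (A.prod B) B' g) : IsDivisorGenerated B' :=
  (hA.prod hB hAB hBA).isDivisorGenerated_of_avSlots hg

/-- **The Hodge conjecture for every `(A × B)^{N+1}`**, unconditionally. [cite: MoonenZarhin1999LowDim, §3 Thm. (3.2)(1)]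
[cite: Hazama1989, Thm. (= Gordon 7.6.2)] -/
theorem HasRealSp4Blocks.hodgeConjectureFor_prod_powSucc (hA : HasRealSp4Blocks A) (hB : HasRealSp4Blocks B)
    (hAB : ∀ f : A ⟶ B, f = 0) (hBA : ∀ g : B ⟶ A, g = 0) (N : ℕ) :
    HodgeConjectureFor (((A.prod B).powSucc N)).dim ((A.prod B).powSucc N).X :=
  (hA.prod hB hAB hBA).hodgeConjectureFor_powSucc N

/-- **`B = D` for every mixed power `A^{M+1} × B^{N+1}`** (a retract of `(A × B)^{max+1}`, `MixedPowersRetract`).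
[cite: MoonenZarhin1999LowDim, §3 Thm. (3.2)(1)] [cite: vanGeemen1994HodgeAV, §2.4–2.5 (p. 235) and §3.6–3.7 (p. 236)] -/
theorem HasRealSp4Blocks.isDivisorGenerated_powSucc_prod_powSucc (hA : HasRealSp4Blocks A)
    (hB : HasRealSp4Blocks B) (hAB : ∀ f : A ⟶ B, f = 0) (hBA : ∀ g : B ⟶ A, g = 0) (M N : ℕ) :
    IsDivisorGenerated ((A.powSucc M).prod (B.powSucc N)) :=
  IsDivisorGenerated.powSucc_prod_powSucc_of_forall_prod_powSucc
    (hA.prod hB hAB hBA).isDivisorGenerated_powSucc M N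

/-- **Condition (D) for every mixed power `A^{M+1} × B^{N+1}`** (it has slots over `A × B` up to the retract:
`(A^{M+1} × B^{N+1})^{K+1}` is again a mixed power up to isomorphism — here through `IsStablyNondegenerate.of_isIsogenous`
and the tree's `StablyNondegenerateProducts`: every power of `A × B` is divisorial and `A^{M+1} × B^{N+1}`-powers are
retracts of powers of `A × B`). For two ORTHOGONAL relative-dimension-two real-multiplication varieties this is the
conclusion of the named fact `Hazama1989_stablyNondegenerate_prod`, now a theorem. [cite: MoonenZarhin1999LowDim, §3 Thm. (3.2)(1)]
[cite: Hazama1989, Thm. (= Gordon 7.6.2)] -/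
theorem HasRealSp4Blocks.hodgeConjectureFor_powSucc_prod_powSucc (hA : HasRealSp4Blocks A)
    (hB : HasRealSp4Blocks B) (hAB : ∀ f : A ⟶ B, f = 0) (hBA : ∀ g : B ⟶ A, g = 0) (M N : ℕ) :
    HodgeConjectureFor ((A.powSucc M).prod (B.powSucc N)).dim ((A.powSucc M).prod (B.powSucc N)).X :=
  hodgeConjectureFor_of_isDivisorGenerated _ (hA.isDivisorGenerated_powSucc_prod_powSucc hB hAB hBA M N)

/-- The Hodge conjecture for everything isogenous to some `A^{M+1} × B^{N+1}`. [cite: vanGeemen1994HodgeAV, Lemma 3.7]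
[cite: MoonenZarhin1999LowDim, §3 Thm. (3.2)(1)] -/
theorem HasRealSp4Blocks.hodgeConjectureFor_of_isIsogenous_powSucc_prod_powSucc (hA : HasRealSp4Blocks A)
    (hB : HasRealSp4Blocks B) (hAB : ∀ f : A ⟶ B, f = 0) (hBA : ∀ g : B ⟶ A, g = 0) {X : AbelianVariety ℂ}
    {M N : ℕ} (hX : X.IsIsogenous ((A.powSucc M).prod (B.powSucc N))) : HodgeConjectureFor X.dim X.X :=
  HodgeConjectureFor.of_isIsogenous hX (hA.hodgeConjectureFor_powSucc_prod_powSucc hB hAB hBA M N)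

/-- **Two ORTHOGONAL real-multiplication varieties of relative dimension two — UNCONDITIONAL** (no Hazama binder):
`Hom(A, B) = 0 = Hom(B, A)` (e.g. `A`, `B` simple and non-isogenous), `End⁰(A) = F_A`, `End⁰(B) = F_B` totally real
fields with `2[F_A:ℚ] = dim A`, `2[F_B:ℚ] = dim B`: the Hodge conjecture for every `A^{M+1} × B^{N+1}`.
[cite: MoonenZarhin1999LowDim, §3 Thm. (3.2)(1)] [cite: Hazama1989, Thm. (= Gordon 7.6.2)] [cite: MoonenZarhin1995Duke, Type I(2)] -/
theorem hodgeConjectureFor_powSucc_prod_powSucc_of_relDimTwo_of_orthogonal (A B : AbelianVariety ℂ)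
    (hFA : IsField A.endAlgebra) [IsTotallyReal (EndField A hFA)] (hdegA : 2 * Module.finrank ℚ A.endAlgebra = A.dim)
    (hFB : IsField B.endAlgebra) [IsTotallyReal (EndField B hFB)] (hdegB : 2 * Module.finrank ℚ B.endAlgebra = B.dim)
    (hAB : ∀ f : A ⟶ B, f = 0) (hBA : ∀ g : B ⟶ A, g = 0) (M N : ℕ) :
    HodgeConjectureFor ((A.powSucc M).prod (B.powSucc N)).dim ((A.powSucc M).prod (B.powSucc N)).X :=
  (hasRealSp4Blocks_of_isTotallyReal_of_two_mul_finrank_eq A hFA hdegA).hodgeConjectureFor_powSucc_prod_powSucc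
    (hasRealSp4Blocks_of_isTotallyReal_of_two_mul_finrank_eq B hFB hdegB) hAB hBA M N

/-- **Condition (D) for `A × B`**, two orthogonal relative-dimension-two real-multiplication varieties — unconditional.
[cite: MoonenZarhin1999LowDim, §3 Thm. (3.2)(1)] [cite: Hazama1989, Thm. (= Gordon 7.6.2)] -/
theorem isStablyNondegenerate_prod_of_relDimTwo_of_orthogonal (A B : AbelianVariety ℂ)
    (hFA : IsField A.endAlgebra) [IsTotallyReal (EndField A hFA)] (hdegA : 2 * Module.finrank ℚ A.endAlgebra = A.dim)
    (hFB : IsField B.endAlgebra) [IsTotallyReal (EndField B hFB)] (hdegB : 2 * Module.finrank ℚ B.endAlgebra = B.dim)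
    (hAB : ∀ f : A ⟶ B, f = 0) (hBA : ∀ g : B ⟶ A, g = 0) : IsStablyNondegenerate (A.prod B) :=
  (hasRealSp4Blocks_of_isTotallyReal_of_two_mul_finrank_eq A hFA hdegA).isStablyNondegenerate_prod
    (hasRealSp4Blocks_of_isTotallyReal_of_two_mul_finrank_eq B hFB hdegB) hAB hBA

end Products

end Literature.AlgebraicGeometry.HodgeTheory

end
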